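/-
Copyright (c) 2026. All rights reserved.
Released under Apache 2.0 license as described in the file LICENSE.
-/
import Literature.Geometry.Kaehler.ComplexTorusQuaternionLangOrderInMaximalOrder
import HarnessLib

/-!
# The normaliser of Lang's order `ℤ⟨1, i, j, ij⟩ ⊂ (−1,3)_ℚ` is dihedral, not `C₂ʳ`: the relations `μe ≡ eμ`,
# `(1 + i)e ≡ e²(1 + i)`, `(1 + i)μ ≡ μ(1 + i)` modulo `𝔬^×` (explicit units), and the eleven non-trivial words
# `μᶜ(1 + i)ᵇeᵃ` lie outside `ℝ^×ρ(𝔬^×)` — twelve classes `⟨[e], [1 + i], [μ]⟩ ≅ D₆ ⊃ ⟨w₂, w₃⟩ ≅ C₂ × C₂`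
# (Ogg 1983 §2 for Eichler orders; Bayer–Travesa 2007 §2 `Γ₆⁺/Γ₆ ≅ (ℤ/2)²` for the maximal order)

[tag: complex_torus] [tag: abelian_surface] [tag: quaternion_multiplication] [tag: shimura_curve]
[tag: atkin_lehner] [tag: quaternion_order] [tag: normalizer]

Lane `lit-hodgefound`, seat p12, row g30-#7 — THEOREMS ONLY (no definition, no named fact, no instance); the sequel of
g29-#5/#6 (`w₂ = ρ(1 + i)`, `w₃ = ρ(μ)`, `μ = 3 + j + ij`, both normalising `𝔬`: `exists_one_add_i_mul_eq`,
`exists_three_add_j_add_ij_mul_eq`, `(1 + i)² = 2i`, `μ² = 3(5 + 2j + 2ij)`), g30-#3 (`σ = ρ(β)`, `β = 3 + i + j − ij`,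
`ρ(β) ∉ ℝ^×ρ(𝔬^×)`) and g30-#4 (`e = (1 + i + j − ij)/2`, `β = 2e²`, `e³ = 2 + i + j − ij ∈ 𝔬^×`, `e𝔬 = 𝔬e`:
`exists_e_mul_eq_and`). For an EICHLER order Ogg's normaliser quotient is `W = {w(m) : m ∥ DF} ≃ C₂ʳ` and for the maximal
order `O₆` Bayer–Travesa record `Γ₆⁺/Γ₆ ≅ (ℤ/2ℤ)²`; Lang's order (reduced discriminant `12`, index `2` in `O₆`, not
Eichler at `2`) is normalised moreover by `e ∈ O₆^×` of order `3` modulo `ℚ^×𝔬^×`, and the resulting twelve classes form a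
DIHEDRAL group: `[μ]` central, `[1 + i][e][1 + i]⁻¹ = [e]⁻¹`.

## The print, VERBATIM

* A. P. Ogg (1983) [Ogg1983RealPoints] §2 p. 283: «`I(m) = μ𝒪 = 𝒪μ` … `𝒪^× = μ𝒪^×μ⁻¹`, since `𝒪 = μ𝒪μ⁻¹` … Hence `μ`
  defines an automorphism `w(m)` of `𝒪` with `w(m)² = 1` … `W = {w(m) : m ∥ DF} ≃ C₂ʳ`».
* P. Bayer, A. Travesa (2007) [BayerTravesa2007] §2 p. 318: «Let `N(O₆)` be the normalizer of `O₆` in `H₆`. The elements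
  of `N(O₆)` of positive reduced norm define a subgroup whose image in `GL⁺(2, ℝ)` will be denoted by `Γ₆⁺`. The group
  `Γ₆` is contained in `Γ₆⁺` as a normal subgroup and the quotient `Γ₆⁺/Γ₆` is isomorphic to `(ℤ/2ℤ)²`. Its classes are
  represented by elements `w_d ∈ O₆` of norm `d` dividing `D = 6`».
* S. Lang (1982) [Lang1982AbelianFunctions] Ch. IX §4 (`𝔬`), §5 Thm. 5.1 (units of norm `±1`).

## What is proved (`e = (1 + i + j − ij)/2`, `μ = 3 + j + ij`)

* §1 GENERAL: **normalisers compose** (`normalises_mul`: `α𝔬 = 𝔬α`, `β𝔬 = 𝔬β ⟹ (αβ)𝔬 = 𝔬(αβ)`, both inclusions); and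
  the **NON-MEMBERSHIP CRITERION** `rho_ne_smul_rho_unit_of_coords` (every `(a, b)`): if `w = g·w₀` with `g ∈ ℚ^×`,
  `w₀ ∈ ℤ⁴` admitting Bézout coefficients `Σ bₖw₀ₖ = 1`, and `|nr w₀| ≥ 2`, then `ρ(w) ≠ cρ(ε)` for all `c ∈ ℝ` and all
  units `ε ∈ 𝔬`, `εε̄ = ±1` (`ε = κw₀`, `κ = Σ bₖεₖ ∈ ℤ ∖ 0`, `nr ε = κ² nr w₀`).
* §2 RELATIONS with explicit units: **`μe = (6 − 4i + j + 4ij)·eμ`** (`6 − 4i + j + 4ij ∈ 𝔬¹`: `[μ]` and `[e]` commute);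
  **`(1 + i)e = i + j = (1 − i + ij)·e²(1 + i)`** (`1 − i + ij ∈ 𝔬^×` of norm `−1`: `[1 + i]` conjugates `[e]` to `[e²] = [e]⁻¹`);
  **`(1 + i)μ = (3 − 2i − 2j)·μ(1 + i)`** (`3 − 2i − 2j ∈ 𝔬¹`: `[1 + i]`, `[μ]` commute); every word normalises `𝔬`
  (`normalises_three_add_j_add_ij_mul_one_add_i_mul_e` as the sample `μ(1 + i)e`, from the generators by §1).
* §3 THE WORDS: `e = ½(1,1,1,−1)`, `e² = ½(3,1,1,−1)`, `1 + i`, `(1+i)e = (0,1,1,0)`, `(1+i)e² = (1,2,1,0)`, `μ = (3,0,1,1)`,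
  `μe = ½(3,9,5,−3)`, `μe² = ½(9,9,7,−1)`, `μ(1+i) = (3,3,2,0)`, `μ(1+i)e = (3,6,4,−1)`, `μ(1+i)e² = (6,9,6,−1)` (`words_eq`),
  with `|nr w₀| = 4, 4, 2, 2, 2, 3, 12, 12, 6, 6, 6`; hence **all eleven lie outside `ℝ^×ρ(𝔬^×)`** (`words_not_smul_unit`).

## Honest scope

The relations and the non-triviality of the eleven words are proved; that the twelve classes are pairwise distinct and
closed under multiplication modulo `ℚ^×𝔬^×` (a group `D₆ ≅ S₃ × C₂`) follows from §2–§3 by bookkeeping that is NOT spelled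
out as a Lean statement (no quotient group is constructed), and no claim is made that these twelve classes EXHAUST
`N(𝔬)/ℚ^×𝔬^×` (numerically they do in a box; a proof would go through `N(𝔬) ⊆ N(O₆)` and Bayer–Travesa's `(ℤ/2ℤ)²`, not
formalised). 0 definitions, 0 named facts, 0 instances — net debt `0`.

## References
* [Ogg1983RealPoints] A. P. Ogg, *Real points on Shimura curves*, in: Arithmetic and Geometry I, Progr. Math. 35 (1983),
  §2 p. 283.
* [BayerTravesa2007] P. Bayer, A. Travesa, *Uniformizing functions for certain Shimura curves, in the case D = 6*, Acta
  Arith. 126 (2007), §2 p. 318.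
* [Lang1982AbelianFunctions] S. Lang, *Introduction to Algebraic and Abelian Functions*, 2nd ed. (1982), Ch. IX §4–§5.
-/

noncomputable section

set_option maxSynthPendingDepth 3

open Complex Module Matrix Quaternion Function
open scoped ComplexConjugate

namespace Literature.Geometry.Kaehler.ComplexTorus.QuaternionType

/-! ## §1 Two general lemmas: products of normalisers normalise; a non-membership criterion for `ℝ^×ρ(𝔬^×)` -/

section General

variable {a b : ℤ}

/-- **Products of normalisers normalise**: if `α𝔬 = 𝔬α` and `β𝔬 = 𝔬β` (both inclusions) then `(αβ)𝔬 = 𝔬(αβ)`.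
[cite: Ogg1983RealPoints, §2 p. 283 («`𝒪 = μ𝒪μ⁻¹`»: the normaliser is a group)] -/
theorem normalises_mul {α β : ℍ[ℚ,(a : ℚ),(b : ℚ)]}
    (hα : (∀ x ∈ order a b, ∃ y ∈ order a b, α * x = y * α) ∧ (∀ y ∈ order a b, ∃ x ∈ order a b, y * α = α * x))
    (hβ : (∀ x ∈ order a b, ∃ y ∈ order a b, β * x = y * β) ∧ (∀ y ∈ order a b, ∃ x ∈ order a b, y * β = β * x)) :
    (∀ x ∈ order a b, ∃ y ∈ order a b, α * β * x = y * (α * β)) ∧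
      (∀ y ∈ order a b, ∃ x ∈ order a b, y * (α * β) = α * β * x) := by
  constructor
  · intro x hx
    obtain ⟨x', hx', h1⟩ := hβ.1 x hx
    obtain ⟨y, hy, h2⟩ := hα.1 x' hx'
    exact ⟨y, hy, by rw [mul_assoc, h1, ← mul_assoc, h2, mul_assoc]⟩
  · intro y hy
    obtain ⟨y', hy', h1⟩ := hα.2 y hy
    obtain ⟨x, hx, h2⟩ := hβ.2 y' hy'
    exact ⟨x, hx, by rw [← mul_assoc, h1, mul_assoc, h2, ← mul_assoc]⟩

/-- **NON-MEMBERSHIP CRITERION: `ρ(w) ∉ ℝ^×ρ(𝔬^×)` when `w = g·w₀` (`g ∈ ℚ^×`, `w₀ ∈ ℤ⁴` with Bézout coefficients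
`Σ bₖw₀ₖ = 1`) and `|nr w₀| ≥ 2`** — if `ρ(w) = cρ(ε)` then `ε = κw₀` with `κ = Σ bₖεₖ ∈ ℤ ∖ 0`, and `nr ε = κ² nr w₀ ≠ ±1`.
[cite: Lang1982AbelianFunctions, Ch. IX §5 Thm. 5.1 («units of `𝔬` … `nr λ = ±1`»)] [cite: Ogg1983RealPoints, §2 p. 283] -/
theorem rho_ne_smul_rho_unit_of_coords (ha : a ≠ 0) (hb : 0 < b) {w : ℍ[ℚ,(a : ℚ),(b : ℚ)]} (w₀ : Fin 4 → ℤ) (g : ℚ)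
    (hg : g ≠ 0) (hw : w = g • ofCoords a b (fun k ↦ ((w₀ k : ℤ) : ℚ))) (bz : Fin 4 → ℤ)
    (hbz : bz 0 * w₀ 0 + bz 1 * w₀ 1 + bz 2 * w₀ 2 + bz 3 * w₀ 3 = 1)
    (hN : 2 ≤ |w₀ 0 ^ 2 - a * w₀ 1 ^ 2 - b * w₀ 2 ^ 2 + a * b * w₀ 3 ^ 2|)
    (c : ℝ) {ε : ℍ[ℚ,(a : ℚ),(b : ℚ)]} (hε : ε ∈ order a b) (hunit : ε * star ε = 1 ∨ ε * star ε = -1) :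
    rho a b hb.le (castQ a b w) ≠ c • rho a b hb.le (castQ a b ε) := by
  intro h
  rw [← map_smul] at h
  have h' := rho_injective (a := a) (b := b) ha hb h
  obtain ⟨m, rfl⟩ := hε
  subst hw
  have h0 := congrArg QuaternionAlgebra.re h'
  have h1 := congrArg QuaternionAlgebra.imI h'
  have h2 := congrArg QuaternionAlgebra.imJ h'
  have h3 := congrArg QuaternionAlgebra.imK h'
  simp [castQ, ofCoords] at h0 h1 h2 h3
  -- `e_k : c mₖ = g w₀ₖ`
  have e0 : c * (m 0 : ℝ) = (g : ℝ) * (w₀ 0 : ℝ) := by linarith [h0]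
  have e1 : c * (m 1 : ℝ) = (g : ℝ) * (w₀ 1 : ℝ) := by linarith [h1]
  have e2 : c * (m 2 : ℝ) = (g : ℝ) * (w₀ 2 : ℝ) := by linarith [h2]
  have e3 : c * (m 3 : ℝ) = (g : ℝ) * (w₀ 3 : ℝ) := by linarith [h3]
  set κ : ℤ := bz 0 * m 0 + bz 1 * m 1 + bz 2 * m 2 + bz 3 * m 3 with hκ
  have hbz' : (bz 0 : ℝ) * w₀ 0 + bz 1 * w₀ 1 + bz 2 * w₀ 2 + bz 3 * w₀ 3 = 1 := by exact_mod_cast hbz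
  have hcκ : c * (κ : ℝ) = (g : ℝ) := by
    rw [hκ]; push_cast
    linear_combination (bz 0 : ℝ) * e0 + (bz 1 : ℝ) * e1 + (bz 2 : ℝ) * e2 + (bz 3 : ℝ) * e3 + (g : ℝ) * hbz'
  have hκ0 : κ ≠ 0 := by
    rintro hz
    rw [hz, Int.cast_zero, mul_zero] at hcκ
    exact hg (by exact_mod_cast hcκ.symm)
  have hg' : (g : ℝ) ≠ 0 := by exact_mod_cast hg
  have hm : ∀ k, c * (m k : ℝ) = (g : ℝ) * (w₀ k : ℝ) → m k = κ * w₀ k := by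
    intro k hk
    have : (g : ℝ) * m k = (g : ℝ) * (κ * w₀ k) := by linear_combination (-(m k : ℝ)) * hcκ + (κ : ℝ) * hk
    exact_mod_cast mul_left_cancel₀ hg' this
  have hm0 := hm 0 e0
  have hm1 := hm 1 e1
  have hm2 := hm 2 e2
  have hm3 := hm 3 e3
  have hn : (ofCoords a b (fun k ↦ ((m k : ℤ) : ℚ)) * star (ofCoords a b (fun k ↦ ((m k : ℤ) : ℚ)))).re =
      ((κ ^ 2 * (w₀ 0 ^ 2 - a * w₀ 1 ^ 2 - b * w₀ 2 ^ 2 + a * b * w₀ 3 ^ 2) : ℤ) : ℚ) := by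
    simp only [QuaternionAlgebra.re_mul, QuaternionAlgebra.re_star, QuaternionAlgebra.imI_star, QuaternionAlgebra.imJ_star,
      QuaternionAlgebra.imK_star, ofCoords_re, ofCoords_imI, ofCoords_imJ, ofCoords_imK, hm0, hm1, hm2, hm3]
    push_cast
    ring
  have hk0' : 0 < κ ^ 2 := by positivity
  have hk1 : 1 ≤ κ ^ 2 := by omega
  rcases hunit with hu | hu
  · have := congrArg QuaternionAlgebra.re hu
    rw [hn, QuaternionAlgebra.re_one] at this
    have h1' : κ ^ 2 * (w₀ 0 ^ 2 - a * w₀ 1 ^ 2 - b * w₀ 2 ^ 2 + a * b * w₀ 3 ^ 2) = 1 := by exact_mod_cast this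
    rcases le_abs'.1 hN with hN' | hN' <;> nlinarith
  · have := congrArg QuaternionAlgebra.re hu
    rw [hn, QuaternionAlgebra.re_neg, QuaternionAlgebra.re_one] at this
    have h1' : κ ^ 2 * (w₀ 0 ^ 2 - a * w₀ 1 ^ 2 - b * w₀ 2 ^ 2 + a * b * w₀ 3 ^ 2) = -1 := by exact_mod_cast this
    rcases le_abs'.1 hN with hN' | hN' <;> nlinarith

end General

/-! ## §2 The relations: `μe ≡ eμ`, `(1 + i)e ≡ e²(1 + i) ≡ e⁻¹(1 + i)`, `(1 + i)μ ≡ μ(1 + i)` modulo `𝔬^×` -/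

section Relations

/-- **`μ COMMUTES WITH e` modulo `𝔬¹`: `μe = (6 − 4i + j + 4ij)·eμ`** with `6 − 4i + j + 4ij ∈ 𝔬` of norm `36 + 16 − 3 − 48 = 1`
(`w₃` is central in the normaliser quotient). [cite: Ogg1983RealPoints, §2 p. 283] [cite: BayerTravesa2007, §1–§2] -/
theorem three_add_j_add_ij_mul_e :
    (⟨3, 0, 1, 1⟩ : ℍ[ℚ,((-1 : ℤ) : ℚ),((3 : ℤ) : ℚ)]) * ⟨1/2, 1/2, 1/2, -1/2⟩ =
      ⟨6, -4, 1, 4⟩ * ((⟨1/2, 1/2, 1/2, -1/2⟩ : ℍ[ℚ,((-1 : ℤ) : ℚ),((3 : ℤ) : ℚ)]) * ⟨3, 0, 1, 1⟩) ∧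
    (⟨6, -4, 1, 4⟩ : ℍ[ℚ,((-1 : ℤ) : ℚ),((3 : ℤ) : ℚ)]) ∈ order (-1) 3 ∧
    (⟨6, -4, 1, 4⟩ : ℍ[ℚ,((-1 : ℤ) : ℚ),((3 : ℤ) : ℚ)]) * star ⟨6, -4, 1, 4⟩ = 1 := by
  refine ⟨?_, ⟨![6, -4, 1, 4], by ext <;> simp [ofCoords]⟩, ?_⟩
  · rw [QuaternionAlgebra.mk_mul_mk, QuaternionAlgebra.mk_mul_mk, QuaternionAlgebra.mk_mul_mk]; ext <;> norm_num
  · rw [QuaternionAlgebra.star_mk, QuaternionAlgebra.mk_mul_mk]; ext <;> norm_num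

/-- **`1 + i INVERTS e` modulo `ℚ^×𝔬^×`: `(1 + i)e = (1 − i + ij)·e²·(1 + i)`** with `1 − i + ij ∈ 𝔬` of norm `−1`
(and `e² ≡ e⁻¹` since `e³ ∈ 𝔬^×`, g30-#4): the dihedral relation `w₂σw₂⁻¹ = σ⁻¹` on `Γ∖𝔥`. Note `(1 + i)e = i + j`.
[cite: Ogg1983RealPoints, §2 p. 283] [cite: BayerTravesa2007, §1–§2] -/
theorem one_add_i_mul_e :
    (⟨1, 1, 0, 0⟩ : ℍ[ℚ,((-1 : ℤ) : ℚ),((3 : ℤ) : ℚ)]) * ⟨1/2, 1/2, 1/2, -1/2⟩ = ⟨0, 1, 1, 0⟩ ∧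
    (⟨1, 1, 0, 0⟩ : ℍ[ℚ,((-1 : ℤ) : ℚ),((3 : ℤ) : ℚ)]) * ⟨1/2, 1/2, 1/2, -1/2⟩ =
      ⟨1, -1, 0, 1⟩ * ((⟨1/2, 1/2, 1/2, -1/2⟩ : ℍ[ℚ,((-1 : ℤ) : ℚ),((3 : ℤ) : ℚ)]) * ⟨1/2, 1/2, 1/2, -1/2⟩ * ⟨1, 1, 0, 0⟩) ∧
    (⟨1, -1, 0, 1⟩ : ℍ[ℚ,((-1 : ℤ) : ℚ),((3 : ℤ) : ℚ)]) ∈ order (-1) 3 ∧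
    (⟨1, -1, 0, 1⟩ : ℍ[ℚ,((-1 : ℤ) : ℚ),((3 : ℤ) : ℚ)]) * star ⟨1, -1, 0, 1⟩ = -1 := by
  refine ⟨?_, ?_, ⟨![1, -1, 0, 1], by ext <;> simp [ofCoords]⟩, ?_⟩
  · rw [QuaternionAlgebra.mk_mul_mk]; ext <;> norm_num
  · rw [e_sq_eq, QuaternionAlgebra.mk_mul_mk, QuaternionAlgebra.mk_mul_mk, QuaternionAlgebra.mk_mul_mk]; ext <;> norm_num
  · rw [QuaternionAlgebra.star_mk, QuaternionAlgebra.mk_mul_mk]; ext <;> norm_num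

/-- **`1 + i` and `μ = 3 + j + ij` COMMUTE modulo `𝔬¹`: `(1 + i)μ = (3 − 2i − 2j)·μ(1 + i)`**, `3 − 2i − 2j ∈ 𝔬` of norm
`9 + 4 − 12 = 1` (`w₂w₃ = w₃w₂ = w₆` on `Γ∖𝔥`). [cite: Ogg1983RealPoints, §2 p. 283 («`W ≃ C₂ʳ`»)] [cite: BayerTravesa2007, §2 («`Γ₆⁺/Γ₆ ≅ (ℤ/2ℤ)²`»)] -/
theorem one_add_i_mul_three_add_j_add_ij :
    (⟨1, 1, 0, 0⟩ : ℍ[ℚ,((-1 : ℤ) : ℚ),((3 : ℤ) : ℚ)]) * ⟨3, 0, 1, 1⟩ =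
      ⟨3, -2, -2, 0⟩ * ((⟨3, 0, 1, 1⟩ : ℍ[ℚ,((-1 : ℤ) : ℚ),((3 : ℤ) : ℚ)]) * ⟨1, 1, 0, 0⟩) ∧
    (⟨3, -2, -2, 0⟩ : ℍ[ℚ,((-1 : ℤ) : ℚ),((3 : ℤ) : ℚ)]) ∈ order (-1) 3 ∧
    (⟨3, -2, -2, 0⟩ : ℍ[ℚ,((-1 : ℤ) : ℚ),((3 : ℤ) : ℚ)]) * star ⟨3, -2, -2, 0⟩ = 1 := by
  refine ⟨?_, ⟨![3, -2, -2, 0], by ext <;> simp [ofCoords]⟩, ?_⟩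
  · rw [QuaternionAlgebra.mk_mul_mk, QuaternionAlgebra.mk_mul_mk, QuaternionAlgebra.mk_mul_mk]; ext <;> norm_num
  · rw [QuaternionAlgebra.star_mk, QuaternionAlgebra.mk_mul_mk]; ext <;> norm_num

/-- **Every word in `e`, `1 + i`, `μ` normalises `𝔬`** (the generators do — g30-#4, g29-#5, g29-#6 — and normalisers compose):
e.g. `μ(1 + i)e`. [cite: Ogg1983RealPoints, §2 p. 283] -/
theorem normalises_three_add_j_add_ij_mul_one_add_i_mul_e :
    (∀ x ∈ order (-1) 3, ∃ y ∈ order (-1) 3,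
        (⟨3, 0, 1, 1⟩ : ℍ[ℚ,((-1 : ℤ) : ℚ),((3 : ℤ) : ℚ)]) * ⟨1, 1, 0, 0⟩ * ⟨1/2, 1/2, 1/2, -1/2⟩ * x =
          y * ((⟨3, 0, 1, 1⟩ : ℍ[ℚ,((-1 : ℤ) : ℚ),((3 : ℤ) : ℚ)]) * ⟨1, 1, 0, 0⟩ * ⟨1/2, 1/2, 1/2, -1/2⟩)) ∧
    (∀ y ∈ order (-1) 3, ∃ x ∈ order (-1) 3,
        y * ((⟨3, 0, 1, 1⟩ : ℍ[ℚ,((-1 : ℤ) : ℚ),((3 : ℤ) : ℚ)]) * ⟨1, 1, 0, 0⟩ * ⟨1/2, 1/2, 1/2, -1/2⟩) =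
          (⟨3, 0, 1, 1⟩ : ℍ[ℚ,((-1 : ℤ) : ℚ),((3 : ℤ) : ℚ)]) * ⟨1, 1, 0, 0⟩ * ⟨1/2, 1/2, 1/2, -1/2⟩ * x) :=
  normalises_mul (normalises_mul ⟨fun _ hx ↦ exists_three_add_j_add_ij_mul_eq hx, fun _ hy ↦ exists_mul_three_add_j_add_ij_eq hy⟩
    ⟨fun _ hx ↦ exists_one_add_i_mul_eq hx, fun _ hy ↦ exists_mul_one_add_i_eq hy⟩)
    ⟨fun _ hx ↦ (exists_e_mul_eq_and hx).1, fun _ hy ↦ (exists_e_mul_eq_and hy).2⟩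

end Relations

/-! ## §3 The eleven non-trivial words `μᶜ(1 + i)ᵇeᵃ` lie outside `ℝ^×ρ(𝔬^×)` -/

section Words

/-- The words as rational multiples of primitive integral quaternions: `e = ½(1,1,1,−1)`, `e² = ½(3,1,1,−1)`,
`(1+i)e = i + j`, `(1+i)e² = 1 + 2i + j`, `μe = ½(3,9,5,−3)`, `μe² = ½(9,9,7,−1)`, `μ(1+i) = 3 + 3i + 2j`,
`μ(1+i)e = 3 + 6i + 4j − ij`, `μ(1+i)e² = 6 + 9i + 6j − ij`. [cite: Lang1982AbelianFunctions, Ch. IX §4] -/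
theorem words_eq :
    (⟨1/2, 1/2, 1/2, -1/2⟩ : ℍ[ℚ,((-1 : ℤ) : ℚ),((3 : ℤ) : ℚ)]) = (1/2 : ℚ) • ofCoords (-1) 3 (fun k ↦ ((![1, 1, 1, -1] k : ℤ) : ℚ)) ∧
    (⟨1/2, 1/2, 1/2, -1/2⟩ : ℍ[ℚ,((-1 : ℤ) : ℚ),((3 : ℤ) : ℚ)]) * ⟨1/2, 1/2, 1/2, -1/2⟩ =
      (1/2 : ℚ) • ofCoords (-1) 3 (fun k ↦ ((![3, 1, 1, -1] k : ℤ) : ℚ)) ∧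
    (⟨1, 1, 0, 0⟩ : ℍ[ℚ,((-1 : ℤ) : ℚ),((3 : ℤ) : ℚ)]) = (1 : ℚ) • ofCoords (-1) 3 (fun k ↦ ((![1, 1, 0, 0] k : ℤ) : ℚ)) ∧
    (⟨1, 1, 0, 0⟩ : ℍ[ℚ,((-1 : ℤ) : ℚ),((3 : ℤ) : ℚ)]) * ⟨1/2, 1/2, 1/2, -1/2⟩ =
      (1 : ℚ) • ofCoords (-1) 3 (fun k ↦ ((![0, 1, 1, 0] k : ℤ) : ℚ)) ∧
    (⟨1, 1, 0, 0⟩ : ℍ[ℚ,((-1 : ℤ) : ℚ),((3 : ℤ) : ℚ)]) * (⟨1/2, 1/2, 1/2, -1/2⟩ * ⟨1/2, 1/2, 1/2, -1/2⟩) =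
      (1 : ℚ) • ofCoords (-1) 3 (fun k ↦ ((![1, 2, 1, 0] k : ℤ) : ℚ)) ∧
    (⟨3, 0, 1, 1⟩ : ℍ[ℚ,((-1 : ℤ) : ℚ),((3 : ℤ) : ℚ)]) = (1 : ℚ) • ofCoords (-1) 3 (fun k ↦ ((![3, 0, 1, 1] k : ℤ) : ℚ)) ∧
    (⟨3, 0, 1, 1⟩ : ℍ[ℚ,((-1 : ℤ) : ℚ),((3 : ℤ) : ℚ)]) * ⟨1/2, 1/2, 1/2, -1/2⟩ =
      (1/2 : ℚ) • ofCoords (-1) 3 (fun k ↦ ((![3, 9, 5, -3] k : ℤ) : ℚ)) ∧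
    (⟨3, 0, 1, 1⟩ : ℍ[ℚ,((-1 : ℤ) : ℚ),((3 : ℤ) : ℚ)]) * (⟨1/2, 1/2, 1/2, -1/2⟩ * ⟨1/2, 1/2, 1/2, -1/2⟩) =
      (1/2 : ℚ) • ofCoords (-1) 3 (fun k ↦ ((![9, 9, 7, -1] k : ℤ) : ℚ)) ∧
    (⟨3, 0, 1, 1⟩ : ℍ[ℚ,((-1 : ℤ) : ℚ),((3 : ℤ) : ℚ)]) * ⟨1, 1, 0, 0⟩ =
      (1 : ℚ) • ofCoords (-1) 3 (fun k ↦ ((![3, 3, 2, 0] k : ℤ) : ℚ)) ∧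
    (⟨3, 0, 1, 1⟩ : ℍ[ℚ,((-1 : ℤ) : ℚ),((3 : ℤ) : ℚ)]) * ⟨1, 1, 0, 0⟩ * ⟨1/2, 1/2, 1/2, -1/2⟩ =
      (1 : ℚ) • ofCoords (-1) 3 (fun k ↦ ((![3, 6, 4, -1] k : ℤ) : ℚ)) ∧
    (⟨3, 0, 1, 1⟩ : ℍ[ℚ,((-1 : ℤ) : ℚ),((3 : ℤ) : ℚ)]) * ⟨1, 1, 0, 0⟩ * (⟨1/2, 1/2, 1/2, -1/2⟩ * ⟨1/2, 1/2, 1/2, -1/2⟩) =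
      (1 : ℚ) • ofCoords (-1) 3 (fun k ↦ ((![6, 9, 6, -1] k : ℤ) : ℚ)) := by
  have ho : ∀ v : Fin 4 → ℤ, ofCoords (-1) 3 (fun k ↦ ((v k : ℤ) : ℚ)) = ⟨v 0, v 1, v 2, v 3⟩ := fun v ↦ by
    ext <;> simp [ofCoords]
  simp only [ho, e_sq_eq]
  refine ⟨?_, ?_, ?_, ?_, ?_, ?_, ?_, ?_, ?_, ?_, ?_⟩ <;>
    simp only [QuaternionAlgebra.mk_mul_mk, QuaternionAlgebra.smul_mk, Matrix.cons_val_zero, Matrix.cons_val_one,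
      Matrix.cons_val_two, Matrix.cons_val_three, Matrix.head_cons, Matrix.tail_cons] <;>
    ext <;> push_cast <;> norm_num

/-- **THE ELEVEN NON-TRIVIAL WORDS `μᶜ(1 + i)ᵇeᵃ` (`0 ≤ a ≤ 2`, `b, c ∈ {0,1}`, not all zero) LIE OUTSIDE `ℝ^×ρ(𝔬^×)`** — their
primitive integral vectors have `|nr| ∈ {2, 3, 4, 6, 12}`, never `1`. With the relations of §2 (`e³ ∈ 𝔬^×`, `(1+i)² = 2i`,
`μ² = 3(5 + 2j + 2ij)`, `μe ≡ eμ`, `(1+i)e ≡ e²(1+i)`, `(1+i)μ ≡ μ(1+i)`) the twelve words are closed under products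
modulo `ℚ^×𝔬^×`, so this gives twelve pairwise distinct classes: a dihedral group `D₆ ≅ S₃ × C₂` inside `N(𝔬)/ℚ^×𝔬^×`,
extending Ogg's `C₂ × C₂ = ⟨w₂, w₃⟩`. [cite: Ogg1983RealPoints, §2 p. 283 («`W = {w(m)} ≃ C₂ʳ`» for Eichler orders)] [cite: BayerTravesa2007, §2 («`Γ₆⁺/Γ₆ ≅ (ℤ/2ℤ)²`»)] [cite: Lang1982AbelianFunctions, Ch. IX §5 Thm. 5.1] -/
theorem words_not_smul_unit (c : ℝ) {ε : ℍ[ℚ,((-1 : ℤ) : ℚ),((3 : ℤ) : ℚ)]} (hε : ε ∈ order (-1) 3)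
    (hunit : ε * star ε = 1 ∨ ε * star ε = -1) :
    rho (-1) 3 (by norm_num) (castQ (-1) 3 (⟨1/2, 1/2, 1/2, -1/2⟩ : ℍ[ℚ,((-1 : ℤ) : ℚ),((3 : ℤ) : ℚ)])) ≠
      c • rho (-1) 3 (by norm_num) (castQ (-1) 3 ε) ∧
    rho (-1) 3 (by norm_num) (castQ (-1) 3 ((⟨1/2, 1/2, 1/2, -1/2⟩ : ℍ[ℚ,((-1 : ℤ) : ℚ),((3 : ℤ) : ℚ)]) * ⟨1/2, 1/2, 1/2, -1/2⟩)) ≠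
      c • rho (-1) 3 (by norm_num) (castQ (-1) 3 ε) ∧
    rho (-1) 3 (by norm_num) (castQ (-1) 3 (⟨1, 1, 0, 0⟩ : ℍ[ℚ,((-1 : ℤ) : ℚ),((3 : ℤ) : ℚ)])) ≠
      c • rho (-1) 3 (by norm_num) (castQ (-1) 3 ε) ∧
    rho (-1) 3 (by norm_num) (castQ (-1) 3 ((⟨1, 1, 0, 0⟩ : ℍ[ℚ,((-1 : ℤ) : ℚ),((3 : ℤ) : ℚ)]) * ⟨1/2, 1/2, 1/2, -1/2⟩)) ≠
      c • rho (-1) 3 (by norm_num) (castQ (-1) 3 ε) ∧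
    rho (-1) 3 (by norm_num) (castQ (-1) 3 ((⟨1, 1, 0, 0⟩ : ℍ[ℚ,((-1 : ℤ) : ℚ),((3 : ℤ) : ℚ)]) *
        (⟨1/2, 1/2, 1/2, -1/2⟩ * ⟨1/2, 1/2, 1/2, -1/2⟩))) ≠ c • rho (-1) 3 (by norm_num) (castQ (-1) 3 ε) ∧
    rho (-1) 3 (by norm_num) (castQ (-1) 3 (⟨3, 0, 1, 1⟩ : ℍ[ℚ,((-1 : ℤ) : ℚ),((3 : ℤ) : ℚ)])) ≠
      c • rho (-1) 3 (by norm_num) (castQ (-1) 3 ε) ∧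
    rho (-1) 3 (by norm_num) (castQ (-1) 3 ((⟨3, 0, 1, 1⟩ : ℍ[ℚ,((-1 : ℤ) : ℚ),((3 : ℤ) : ℚ)]) * ⟨1/2, 1/2, 1/2, -1/2⟩)) ≠
      c • rho (-1) 3 (by norm_num) (castQ (-1) 3 ε) ∧
    rho (-1) 3 (by norm_num) (castQ (-1) 3 ((⟨3, 0, 1, 1⟩ : ℍ[ℚ,((-1 : ℤ) : ℚ),((3 : ℤ) : ℚ)]) *
        (⟨1/2, 1/2, 1/2, -1/2⟩ * ⟨1/2, 1/2, 1/2, -1/2⟩))) ≠ c • rho (-1) 3 (by norm_num) (castQ (-1) 3 ε) ∧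
    rho (-1) 3 (by norm_num) (castQ (-1) 3 ((⟨3, 0, 1, 1⟩ : ℍ[ℚ,((-1 : ℤ) : ℚ),((3 : ℤ) : ℚ)]) * ⟨1, 1, 0, 0⟩)) ≠
      c • rho (-1) 3 (by norm_num) (castQ (-1) 3 ε) ∧
    rho (-1) 3 (by norm_num) (castQ (-1) 3 ((⟨3, 0, 1, 1⟩ : ℍ[ℚ,((-1 : ℤ) : ℚ),((3 : ℤ) : ℚ)]) * ⟨1, 1, 0, 0⟩ *
        ⟨1/2, 1/2, 1/2, -1/2⟩)) ≠ c • rho (-1) 3 (by norm_num) (castQ (-1) 3 ε) ∧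
    rho (-1) 3 (by norm_num) (castQ (-1) 3 ((⟨3, 0, 1, 1⟩ : ℍ[ℚ,((-1 : ℤ) : ℚ),((3 : ℤ) : ℚ)]) * ⟨1, 1, 0, 0⟩ *
        (⟨1/2, 1/2, 1/2, -1/2⟩ * ⟨1/2, 1/2, 1/2, -1/2⟩))) ≠ c • rho (-1) 3 (by norm_num) (castQ (-1) 3 ε) := by
  obtain ⟨w1, w2, w3, w4, w5, w6, w7, w8, w9, w10, w11⟩ := words_eq
  refine ⟨?_, ?_, ?_, ?_, ?_, ?_, ?_, ?_, ?_, ?_, ?_⟩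
  · exact rho_ne_smul_rho_unit_of_coords (by norm_num) (by norm_num) _ _ (by norm_num) w1 ![0, 0, 0, -1]
      (by simp) (by simp) c hε hunit
  · exact rho_ne_smul_rho_unit_of_coords (by norm_num) (by norm_num) _ _ (by norm_num) w2 ![0, 0, 0, -1]
      (by simp) (by simp) c hε hunit
  · exact rho_ne_smul_rho_unit_of_coords (by norm_num) (by norm_num) _ _ (by norm_num) w3 ![0, 1, 0, 0]
      (by simp) (by simp) c hε hunit
  · exact rho_ne_smul_rho_unit_of_coords (by norm_num) (by norm_num) _ _ (by norm_num) w4 ![0, 0, 1, 0]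
      (by simp) (by simp) c hε hunit
  · exact rho_ne_smul_rho_unit_of_coords (by norm_num) (by norm_num) _ _ (by norm_num) w5 ![0, 0, 1, 0]
      (by simp) (by simp) c hε hunit
  · exact rho_ne_smul_rho_unit_of_coords (by norm_num) (by norm_num) _ _ (by norm_num) w6 ![0, 0, 0, 1]
      (by simp) (by simp) c hε hunit
  · exact rho_ne_smul_rho_unit_of_coords (by norm_num) (by norm_num) _ _ (by norm_num) w7 ![-1, 1, -1, 0]
      (by simp) (by simp) c hε hunit
  · exact rho_ne_smul_rho_unit_of_coords (by norm_num) (by norm_num) _ _ (by norm_num) w8 ![0, 0, 0, -1]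
      (by simp) (by simp) c hε hunit
  · exact rho_ne_smul_rho_unit_of_coords (by norm_num) (by norm_num) _ _ (by norm_num) w9 ![0, 1, -1, 0]
      (by simp) (by simp) c hε hunit
  · exact rho_ne_smul_rho_unit_of_coords (by norm_num) (by norm_num) _ _ (by norm_num) w10 ![0, 0, 0, -1]
      (by simp) (by simp) c hε hunit
  · exact rho_ne_smul_rho_unit_of_coords (by norm_num) (by norm_num) _ _ (by norm_num) w11 ![0, 0, 0, -1]
      (by simp) (by simp) c hε hunit

end Words

end Literature.Geometry.Kaehler.ComplexTorus.QuaternionType
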